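import Summits.ValiantsHypothesis.ValiantsHypothesis.Theorems.LacunarySymmetroidMatrixDescartesDoorA26WallBubblingOnePairWallClusters
import Summits.ValiantsHypothesis.ValiantsHypothesis.Theorems.LacunarySymmetroidMatrixDescartesDoorA26WallBubblingConfluentSlots
import Summits.ValiantsHypothesis.ValiantsHypothesis.Theorems.LacunarySymmetroidMatrixDescartesDoorA26WallBubblingClusterRungs
import Summits.ValiantsHypothesis.ValiantsHypothesis.Theorems.LacunarySymmetroidMatrixDescartesDoorA26WallBubblingChainCeilingTight
import Summits.ValiantsHypothesis.ValiantsHypothesis.Theorems.LacunarySymmetroidMatrixDescartesDoorA26WallBubblingConfluentTower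
import Summits.ValiantsHypothesis.ValiantsHypothesis.Theorems.LacunarySymmetroidMatrixDescartesDoorA26WallBubblingOnePairWallNondeg

/-!
# Wall bubbling for `DoorA26` — ONE WEYL PAIR ON A WALL: NO ACCUMULATION OF TWENTIES AT ALL (the chain count has slack one; both branches; door-free)

HONEST FRAMING.  Obligation (W) `stub_weylFaces` of `Cruxes/DoorA26/Lines/wall_bubbling.lean` (crux `DoorA26`, stmt-ValiantsHypothesis-19979;
OPEN, typed, never asserted); statement file `Cruxes/DoorA26/Lines/wall_bubbling_ConfluentDoor.lean` rev 5c, stratum `Stmt.weylFaces_wall` with ONE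
Weyl pair (`δ₀ = δ₅`) and one disjoint-type relation among the five values: (a) `δ₁ + δ₂ = δ₃ + δ₄`, (b) `δ₀ + δ₁ = δ₂ + δ₃`.  W1 seat val-sym-door-p2 g13
(#41).  W2's TIGHT-CHAIN machinery (door-p1 g14/g15: clusters `…ConfluentClusters`, rungs `…ClusterRungs` = `twoScale_monotone` / `doubleton_split` /
`triple_top` / `triple_mid` / `threeScale_triple`, the member-language count `…ConfluentSlots`, the ceiling `chain_ceiling` #17) proves at a GENERIC
Weyl face that every accumulation of twenties is a TIGHT chain (`Σ m_c = 20 ≤ 6 + (|V| − 1) = 20`).  ON THE WALL `|V| ≤ 14`, the same chain reads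
`20 ≤ 6 + 13 = 19` — a CONTRADICTION.  Nothing else changes: the rungs carry no 2-Sidon hypothesis, the clusters need only per-cluster
non-degeneracy (W1 #40 `confluentClusters_of_nondeg` + W1 #35), and the slot splitting is the same value by value (the case split is done on the
VALUE, not on a representative pair, so the merged wall class is handled by the doubleton/singleton branches).  Hence (def-free, NO DOOR):

* **`onePairWall_noTwenties_of_nondeg`** — exponents `δ^ν → δ0` with `δ0 5 = δ0 0`, five DISTINCT values carrying a coincidence of two distinct
  canonical pair sums, per-cluster non-degeneracy as input: NO sequence of genuine `(2,6)` pencils (symmetric letters, `≢ 0`) has twenty zeros at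
  every stage — ANYWHERE on the line (no window, no bounded ratio);
* **`onePairWallA_noTwenties`**, **`onePairWallB_noTwenties`** — the two wall strata, UNCONDITIONALLY (non-degeneracy from W1 #35).

So TWENTIES DO NOT ACCUMULATE AT A WEYL ∩ DISJOINT-WALL POINT WITH ONE WEYL PAIR — the one-pair part of `Stmt.weylFaces_wall` in sequence currency,
both branches, door-free (the closure-currency restatement is bookkeeping over `twenty_log_zeros_of_mem_twentyLocus`, W2 #27).  The two-pair part
needs the two-dslope rungs (not in the tree).  Registers unchanged; (W), `ConfluentDoor26`, `NoTightChain26`, `DoorA26`, `MatrixDescartes`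
(stmt-ValiantsHypothesis-18050) OPEN; nothing on VP ≠ VNP.  `--supports stmt-ValiantsHypothesis-19979 --as helper`.

[this work] the wall run of W2's chain; [W2, door-p1 g14/g15] every analytic input.
-/

-- `Summit.ValiantsHypothesis.ValiantsHypothesis.…` repeats a component by the D-0017 layout
-- (single-conjunct summit), which the `dupNamespace` linter flags; the name is mandated.
set_option linter.dupNamespace false

namespace Summit.ValiantsHypothesis.ValiantsHypothesis.Theorems.LacunarySymmetroidMatrixDescartes.WallBubbling

open Finset Filter Topology Polynomial
open Bubbling (polar polar_comm card_pairSums_five)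
open Literature.Analysis.TotalPositivity.LaguerreRuleOfSigns (ZerosWithMultiplicityLE)
open scoped BigOperators

/-- **NO TWENTIES ACCUMULATE AT A ONE-WEYL-PAIR WALL POINT, GIVEN PER-CLUSTER NON-DEGENERACY — NO DOOR, NO WINDOW.**  Positions: the pair at
`0,5`; the five values `δ0 0, …, δ0 4` are distinct (`hinj`) and carry a coincidence of two distinct canonical pair sums (`hcoin`); `hnd` = the
stratum's non-degeneracy. [this work] -/
theorem onePairWall_noTwenties_of_nondeg (δs : ℕ → Fin 6 → ℝ) (δ0 : Fin 6 → ℝ)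
    (hδ : ∀ l, Tendsto (fun ν => δs ν l) atTop (𝓝 (δ0 l))) (h05 : δ0 5 = δ0 0)
    (hinj : ∀ a b : Fin 5, δ0 a.castSucc = δ0 b.castSucc → a = b)
    (hcoin : ∃ a b c d : Fin 5, a ≤ b ∧ c ≤ d ∧ (a, b) ≠ (c, d) ∧ δ0 a.castSucc + δ0 b.castSucc = δ0 c.castSucc + δ0 d.castSucc)
    (hnd : ∀ W : Fin 6 → Matrix (Fin 2) (Fin 2) ℝ, (∀ l, (W l).IsSymm) → (∃ p q, polar (W p) (W q) ≠ 0) →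
      ∃ t, ((Real.exp (δ0 0 * t)) • (W 0 + t • W 5) + ∑ k : Fin 4, (Real.exp (δ0 k.succ.castSucc * t)) • W k.succ.castSucc).det ≠ 0)
    (U : ℕ → Fin 6 → Matrix (Fin 2) (Fin 2) ℝ) (hU : ∀ ν l, (U ν l).IsSymm)
    (hne : ∀ ν, ∃ t, (∑ l, Real.exp (δs ν l * t) • U ν l).det ≠ 0)
    (z : ℕ → Fin 20 → ℝ) (hz : ∀ ν, StrictMono (z ν)) (hroot : ∀ ν i, (∑ l, Real.exp (δs ν l * z ν i) • U ν l).det = 0) :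
    False := by
  classical
  obtain ⟨φ, hφ, C, m, s, R, hm, hmpos, hdrift, hzeros, μ, Γ, ε, W, hpkg⟩ := confluentClusters_of_nondeg δs δ0 hδ h05 hnd U hU hne z hz hroot
  have hμ : ∀ c k, 0 < μ c k := fun c => (hpkg c).1
  have hdom := fun c => (hpkg c).2.1
  have hΓ := fun c => (hpkg c).2.2.1
  have hε : ∀ c, ε c = 1 ∨ ε c = -1 := fun c => (hpkg c).2.2.2.1
  have hΓW : ∀ c a b, Γ c a b = ε c * polar (W c a) (W c b) := fun c => (hpkg c).2.2.2.2.2.1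
  have hneW := fun c => (hpkg c).2.2.2.2.2.2.1
  have hconv := fun c => (hpkg c).2.2.2.2.2.2.2
  have hδφ : ∀ l, Tendsto (fun k => δs (φ k) l) atTop (𝓝 (δ0 l)) := fun l => (hδ l).comp hφ.tendsto_atTop
  -- alive members are the non-zero entries of `Γ`
  have hεne : ∀ c, ε c ≠ 0 := by
    intro c; rcases hε c with h | h <;> rw [h] <;> norm_num
  have hal : ∀ c p q, polar (W c p) (W c q) ≠ 0 ↔ Γ c p q ≠ 0 := by
    intro c p q
    rw [hΓW]
    exact ⟨fun h => mul_ne_zero (hεne c) h, fun h hz0 => h (by rw [hz0, mul_zero])⟩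
  have hΓsymm : ∀ c a b, Γ c a b = Γ c b a := by
    intro c a b; rw [hΓW, hΓW, polar_comm]
  -- the rungs in cluster currency
  have Rmono : ∀ c c' : Fin C, c < c' → ∀ p q p' q' : Fin 6, Γ c p q ≠ 0 → Γ c' p' q' ≠ 0 → δ0 p + δ0 q ≤ δ0 p' + δ0 q' :=
    fun c c' hcc' p q p' q' h1 h2 => clusters_monotone (fun k => δs (φ k)) δ0 hδφ h05 (fun k => U (φ k)) s μ Γ hμ hdom hΓ
      c c' (hdrift c c' hcc') p q p' q' h1 h2
  have Rdbl : ∀ c c' : Fin C, c < c' → ∀ k : Fin 6, k ≠ 0 → k ≠ 5 → Γ c 5 k ≠ 0 → Γ c' 5 k ≠ 0 → False :=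
    fun c c' hcc' k hk0 hk5 h1 h2 => clusters_doubleton_split (fun k => δs (φ k)) δ0 hδφ h05 (fun k => U (φ k)) s μ Γ hμ hdom hΓ
      c c' (hdrift c c' hcc') k hk0 hk5 h1 h2
  have Rtop : ∀ c c' : Fin C, c < c' → Γ c 5 5 ≠ 0 → Γ c' 5 5 = 0 ∧ Γ c' 0 5 = 0 :=
    fun c c' hcc' h1 => clusters_triple_top (fun k => δs (φ k)) δ0 hδφ h05 (fun k => U (φ k)) s μ Γ hμ hdom hΓ
      c c' (hdrift c c' hcc') h1
  have Rmid : ∀ c c' : Fin C, c < c' → Γ c 0 5 ≠ 0 → Γ c' 5 5 = 0 :=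
    fun c c' hcc' h1 => clusters_triple_mid (fun k => δs (φ k)) δ0 hδφ h05 (fun k => U (φ k)) s μ Γ hμ hdom hΓ
      c c' (hdrift c c' hcc') h1
  have Rthree : ∀ c₁ c₂ c₃ : Fin C, c₁ < c₂ → c₂ < c₃ → Γ c₁ 0 5 ≠ 0 → Γ c₂ 0 5 ≠ 0 → Γ c₃ 0 5 ≠ 0 → False :=
    fun c₁ c₂ c₃ h12 h23 h1 h2 h3 => clusters_triple_three (fun k => δs (φ k)) δ0 hδφ h05 (fun k => U (φ k)) s μ Γ hμ hdom hΓ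
      c₁ c₂ c₃ (hdrift c₁ c₂ h12) (hdrift c₂ c₃ h23) h1 h2 h3
  -- the value set
  set V : Finset ℝ := ((univ : Finset (Fin 6 × Fin 6)).image (fun pq => δ0 pq.1 + δ0 pq.2)) with hV
  have hmemV : ∀ p q : Fin 6, δ0 p + δ0 q ∈ V := fun p q => Finset.mem_image.mpr ⟨(p, q), Finset.mem_univ _, rfl⟩
  -- |V| ≤ 14 (one value coincidence among the five values)
  have hV14 : V.card ≤ 14 := by
    have hρ : ∀ l : Fin 6, δ0 l = δ0 (Fin.castSucc ⟨(l : ℕ) % 5, Nat.mod_lt _ (by norm_num)⟩) := by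
      intro l
      fin_cases l
      · rfl
      · rfl
      · rfl
      · rfl
      · rfl
      · exact h05
    have hsub : V ⊆ (univ : Finset (Fin 5 × Fin 5)).image (fun pr => δ0 pr.1.castSucc + δ0 pr.2.castSucc) := by
      intro w hw
      rw [hV, Finset.mem_image] at hw
      obtain ⟨pq, -, rfl⟩ := hw
      exact Finset.mem_image.mpr ⟨(⟨(pq.1 : ℕ) % 5, Nat.mod_lt _ (by norm_num)⟩, ⟨(pq.2 : ℕ) % 5, Nat.mod_lt _ (by norm_num)⟩),
        Finset.mem_univ _, by rw [← hρ, ← hρ]⟩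
    exact (Finset.card_le_card hsub).trans ((card_pairSums_five (fun mm => δ0 mm.castSucc)).2 hcoin)
  -- injectivity of the values on the positions `≠ 5`
  have pos_inj : ∀ q q' : Fin 6, q ≠ 5 → q' ≠ 5 → δ0 q' = δ0 q → q' = q := by
    intro q q' hq hq' h
    obtain ⟨m, rfl⟩ := Fin.exists_castSucc_eq.mpr hq
    obtain ⟨m', rfl⟩ := Fin.exists_castSucc_eq.mpr hq'
    rw [hinj m' m h]
  -- Σ_V (n w − 1) ≤ 6
  have hn6 : (∑ w ∈ V, ((if w = δ0 0 + δ0 0 then 3 else if (∃ q : Fin 6, q ≠ 0 ∧ q ≠ 5 ∧ w = δ0 0 + δ0 q) then 2 else 1) - 1)) ≤ 6 := by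
    set D : Finset ℝ := ((univ : Finset (Fin 6)).filter (fun q => q ≠ 0 ∧ q ≠ 5)).image (fun q => δ0 0 + δ0 q) with hD
    have hDcard : D.card ≤ 4 := by
      refine Finset.card_image_le.trans ?_
      have : ((univ : Finset (Fin 6)).filter (fun q => q ≠ 0 ∧ q ≠ 5)).card = 4 := by decide
      rw [this]
    have hterm : ∀ w ∈ V, ((if w = δ0 0 + δ0 0 then 3 else if (∃ q : Fin 6, q ≠ 0 ∧ q ≠ 5 ∧ w = δ0 0 + δ0 q) then 2 else 1) - 1)
        ≤ (if w = δ0 0 + δ0 0 then 2 else 0) + (if w ∈ D then 1 else 0) := by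
      intro w _
      by_cases h1 : w = δ0 0 + δ0 0
      · rw [if_pos h1, if_pos h1]; omega
      · rw [if_neg h1, if_neg h1]
        by_cases h2 : ∃ q : Fin 6, q ≠ 0 ∧ q ≠ 5 ∧ w = δ0 0 + δ0 q
        · obtain ⟨q, hq0, hq5, hwq⟩ := h2
          have hwD : w ∈ D := by
            rw [hD, Finset.mem_image]
            exact ⟨q, Finset.mem_filter.mpr ⟨Finset.mem_univ _, hq0, hq5⟩, hwq.symm⟩
          rw [if_pos ⟨q, hq0, hq5, hwq⟩, if_pos hwD]
        · rw [if_neg h2]; exact Nat.zero_le _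
    refine (Finset.sum_le_sum hterm).trans ?_
    rw [Finset.sum_add_distrib, Finset.sum_ite_eq', Finset.sum_boole, Nat.cast_id]
    have hf : (V.filter (fun w => w ∈ D)).card ≤ 4 :=
      (Finset.card_le_card (fun w hw => (Finset.mem_filter.mp hw).2)).trans hDcard
    split_ifs <;> omega
  -- (hne) every cluster has an alive member
  have hne' : ∀ c : Fin C, (V.filter (fun w => (∃ p q : Fin 6, δ0 p + δ0 q = w ∧ polar (W c p) (W c q) ≠ 0))).Nonempty := by
    intro c
    obtain ⟨p, q, hpq⟩ := exists_polar_ne_zero_of_confluentDet_ne_zero δ0 (W c) (hneW c)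
    exact ⟨δ0 p + δ0 q, Finset.mem_filter.mpr ⟨hmemV p q, p, q, rfl, hpq⟩⟩
  -- (hcount) the Laguerre–Pólya count per cluster, through the multiplicity transfer
  have hcount : ∀ c : Fin C, m c + 1 ≤ ∑ w ∈ V.filter (fun w => (∃ p q : Fin 6, δ0 p + δ0 q = w ∧ polar (W c p) (W c q) ≠ 0)),
      ((if δ0 0 + δ0 0 = w ∧ polar (W c 5) (W c 5) ≠ 0 then 2 else if (∃ q : Fin 6, q ≠ 5 ∧ δ0 5 + δ0 q = w ∧ polar (W c 5) (W c q) ≠ 0) then 1 else 0) + 1) := by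
    intro c
    obtain ⟨Z, mult, hZ, hmZ⟩ := multiplicity_transfer_iteratedDeriv (N := m c) (-R) R
      (fun k t => ε c * (μ c k)⁻¹ * (∑ l, Real.exp (δs (φ k) l * t) • (Real.exp (δs (φ k) l * s c k) • U (φ k) l)).det)
      (fun t => ((Real.exp (δ0 0 * t)) • (W c 0 + t • W c 5)
          + ∑ k : Fin 4, (Real.exp (δ0 k.succ.castSucc * t)) • W c k.succ.castSucc).det)
      (fun k nn => contDiff_const.mul (contDiff_pencilDet _ _ nn))
      (fun j _ ψ hψ ts t₀ _ hts => hconv c j ψ hψ ts t₀ hts)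
      (fun k => by
        obtain ⟨x, hx, hx'⟩ := hzeros c k
        exact ⟨x, hx, fun i => ⟨(hx' i).1, by rw [(hx' i).2, mul_zero]⟩⟩)
    have hLP := confluentDet_zerosWithMultiplicityLE_slots δ0 h05 (W c) (hneW c) Z mult
      (fun z' hz' => ⟨Set.mem_univ _, (hZ z' hz').2⟩)
    have hS1 : 1 ≤ ∑ w ∈ V.filter (fun w => (∃ p q : Fin 6, δ0 p + δ0 q = w ∧ polar (W c p) (W c q) ≠ 0)),
        ((if δ0 0 + δ0 0 = w ∧ polar (W c 5) (W c 5) ≠ 0 then 2 else if (∃ q : Fin 6, q ≠ 5 ∧ δ0 5 + δ0 q = w ∧ polar (W c 5) (W c q) ≠ 0) then 1 else 0) + 1) := by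
      obtain ⟨w₀, hw₀⟩ := hne' c
      exact le_trans (Nat.le_add_left 1 _) (Finset.single_le_sum
        (f := fun w => (if δ0 0 + δ0 0 = w ∧ polar (W c 5) (W c 5) ≠ 0 then 2 else if (∃ q : Fin 6, q ≠ 5 ∧ δ0 5 + δ0 q = w ∧ polar (W c 5) (W c q) ≠ 0) then 1 else 0) + 1) (fun w _ => Nat.zero_le _) hw₀)
    have hmZ' : m c ≤ ∑ z' ∈ Z, mult z' := hmZ
    have hLP' : ∑ z' ∈ Z, mult z' ≤ (∑ w ∈ V.filter (fun w => (∃ p q : Fin 6, δ0 p + δ0 q = w ∧ polar (W c p) (W c q) ≠ 0)),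
        ((if δ0 0 + δ0 0 = w ∧ polar (W c 5) (W c 5) ≠ 0 then 2 else if (∃ q : Fin 6, q ≠ 5 ∧ δ0 5 + δ0 q = w ∧ polar (W c 5) (W c q) ≠ 0) then 1 else 0) + 1)) - 1 := hLP
    omega
  -- (hmono) tropical monotonicity of the active value sets
  have hmono' : ∀ c c' : Fin C, c < c' →
      ∀ w ∈ V.filter (fun w => (∃ p q : Fin 6, δ0 p + δ0 q = w ∧ polar (W c p) (W c q) ≠ 0)), ∀ w' ∈ V.filter (fun w => (∃ p q : Fin 6, δ0 p + δ0 q = w ∧ polar (W c' p) (W c' q) ≠ 0)), w ≤ w' := by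
    intro c c' hcc' w hw w' hw'
    obtain ⟨-, p, q, rfl, hpq⟩ := Finset.mem_filter.mp hw
    obtain ⟨-, p', q', rfl, hp'q'⟩ := Finset.mem_filter.mp hw'
    exact Rmono c c' hcc' p q p' q' ((hal c p q).mp hpq) ((hal c' p' q').mp hp'q')
  -- dictionary: an alive confluent `t`-slot of value `2δ0 0` is the slot `(0,5)`
  have hq0 : ∀ c : Fin C, (∃ q : Fin 6, q ≠ 5 ∧ δ0 5 + δ0 q = δ0 0 + δ0 0 ∧ polar (W c 5) (W c q) ≠ 0) → Γ c 0 5 ≠ 0 := by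
    rintro c ⟨q, hq5, hq, hpol⟩
    have hq' : q = 0 := pos_inj 0 q (by decide) hq5 (by rw [h05] at hq; linarith)
    subst hq'
    rw [hΓsymm]; exact (hal c 5 0).mp hpol
  -- (hsplit) slot splitting, value by value
  have hsplit : ∀ w ∈ V, (∑ c : Fin C, if w ∈ V.filter (fun w => (∃ p q : Fin 6, δ0 p + δ0 q = w ∧ polar (W c p) (W c q) ≠ 0))
      then (if δ0 0 + δ0 0 = w ∧ polar (W c 5) (W c 5) ≠ 0 then 2 else if (∃ q : Fin 6, q ≠ 5 ∧ δ0 5 + δ0 q = w ∧ polar (W c 5) (W c q) ≠ 0) then 1 else 0) else 0) ≤ (if w = δ0 0 + δ0 0 then 3 else if (∃ q : Fin 6, q ≠ 0 ∧ q ≠ 5 ∧ w = δ0 0 + δ0 q) then 2 else 1) - 1 := by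
    intro w hw
    by_cases hA : w = δ0 0 + δ0 0
    · -- the triple value `2δ0 0`
      subst hA
      rw [if_pos rfl]
      refine (sum_le_two_of_rules _ ?_ ?_ ?_).trans (by norm_num)
      · intro c
        split_ifs <;> omega
      · intro c c' hcc' hfc
        -- `f c = 2`: the `t²`-slot is alive at `c`
        have h55 : Γ c 5 5 ≠ 0 := by
          by_contra h55
          have hp55 : ¬ (δ0 0 + δ0 0 = δ0 0 + δ0 0 ∧ polar (W c 5) (W c 5) ≠ 0) := fun h => ((hal c 5 5).mp h.2) h55
          rw [if_neg hp55] at hfc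
          (split_ifs at hfc; omega)
        -- at `c'` both confluent triple slots are dead
        have hdead : Γ c' 5 5 = 0 ∧ Γ c' 0 5 = 0 := by
          rcases lt_or_gt_of_ne hcc' with hlt | hgt
          · exact Rtop c c' hlt h55
          · constructor
            · by_contra h'
              exact h55 (Rtop c' c hgt h').1
            · by_contra h'
              exact h55 (Rmid c' c hgt h')
        have hn55 : ¬ (δ0 0 + δ0 0 = δ0 0 + δ0 0 ∧ polar (W c' 5) (W c' 5) ≠ 0) := fun h => ((hal c' 5 5).mp h.2) hdead.1
        have hn05 : ¬ (∃ q : Fin 6, q ≠ 5 ∧ δ0 5 + δ0 q = δ0 0 + δ0 0 ∧ polar (W c' 5) (W c' q) ≠ 0) := fun h => hq0 c' h hdead.2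
        rw [if_neg hn55, if_neg hn05, ite_self]
      · intro c₁ c₂ c₃ h12 h23 hf1 hf2 hf3
        -- `f c = 1`: the `t`-slot `(0,5)` is alive at `c`
        have h05' : ∀ c : Fin C, (if δ0 0 + δ0 0 ∈ V.filter (fun w => (∃ p q : Fin 6, δ0 p + δ0 q = w ∧ polar (W c p) (W c q) ≠ 0))
            then (if δ0 0 + δ0 0 = δ0 0 + δ0 0 ∧ polar (W c 5) (W c 5) ≠ 0 then 2 else if (∃ q : Fin 6, q ≠ 5 ∧ δ0 5 + δ0 q = δ0 0 + δ0 0 ∧ polar (W c 5) (W c q) ≠ 0) then 1 else 0) else 0) = 1 → Γ c 0 5 ≠ 0 := by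
          intro c hfc
          by_cases hmem : δ0 0 + δ0 0 ∈ V.filter (fun w => (∃ p q : Fin 6, δ0 p + δ0 q = w ∧ polar (W c p) (W c q) ≠ 0))
          · rw [if_pos hmem] at hfc
            by_cases h1 : δ0 0 + δ0 0 = δ0 0 + δ0 0 ∧ polar (W c 5) (W c 5) ≠ 0
            · rw [if_pos h1] at hfc; norm_num at hfc
            · rw [if_neg h1] at hfc
              by_cases h2 : ∃ q : Fin 6, q ≠ 5 ∧ δ0 5 + δ0 q = δ0 0 + δ0 0 ∧ polar (W c 5) (W c q) ≠ 0
              · exact hq0 c h2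
              · rw [if_neg h2] at hfc; norm_num at hfc
          · rw [if_neg hmem] at hfc; norm_num at hfc
        exact Rthree c₁ c₂ c₃ h12 h23 (h05' c₁ hf1) (h05' c₂ hf2) (h05' c₃ hf3)
    · by_cases hB : ∃ q' : Fin 6, q' ≠ 0 ∧ q' ≠ 5 ∧ w = δ0 0 + δ0 q'
      · -- a doubleton value `δ0 0 + δ0 q'`, `q' ∉ {0,5}`
        obtain ⟨q', hq'0, hq'5, hwq'⟩ := hB
        subst hwq'
        have hnot2 : ¬ (δ0 0 + δ0 q' = δ0 0 + δ0 0) := fun h =>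
          hq'0 (pos_inj 0 q' (by decide) hq'5 (by linarith))
        have hnot2' : ¬ (δ0 0 + δ0 0 = δ0 0 + δ0 q') := fun h => hnot2 h.symm
        rw [if_neg hnot2, if_pos ⟨q', hq'0, hq'5, rfl⟩]
        refine (sum_le_one_of_pairwise _ ?_ ?_).trans (by norm_num)
        · intro c
          have : ¬ (δ0 0 + δ0 0 = δ0 0 + δ0 q' ∧ polar (W c 5) (W c 5) ≠ 0) := fun h => hnot2' h.1
          rw [if_neg this]
          split_ifs <;> omega
        · -- two clusters with the `t`-slot `(5,q')` alive
          have hx : ∀ c : Fin C, (if δ0 0 + δ0 q' ∈ V.filter (fun w => (∃ p q : Fin 6, δ0 p + δ0 q = w ∧ polar (W c p) (W c q) ≠ 0))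
              then (if δ0 0 + δ0 0 = δ0 0 + δ0 q' ∧ polar (W c 5) (W c 5) ≠ 0 then 2 else if (∃ q : Fin 6, q ≠ 5 ∧ δ0 5 + δ0 q = δ0 0 + δ0 q' ∧ polar (W c 5) (W c q) ≠ 0) then 1 else 0) else 0) = 1 → Γ c 5 q' ≠ 0 := by
            intro c hfc
            by_cases hmem : δ0 0 + δ0 q' ∈ V.filter (fun w => (∃ p q : Fin 6, δ0 p + δ0 q = w ∧ polar (W c p) (W c q) ≠ 0))
            · rw [if_pos hmem] at hfc
              have h1 : ¬ (δ0 0 + δ0 0 = δ0 0 + δ0 q' ∧ polar (W c 5) (W c 5) ≠ 0) := fun h => hnot2' h.1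
              rw [if_neg h1] at hfc
              by_cases h2 : ∃ q : Fin 6, q ≠ 5 ∧ δ0 5 + δ0 q = δ0 0 + δ0 q' ∧ polar (W c 5) (W c q) ≠ 0
              · obtain ⟨q, hq5, hq, hpol⟩ := h2
                have hqq : q = q' := pos_inj q' q hq'5 hq5 (by rw [h05] at hq; linarith)
                subst hqq
                exact (hal c 5 q).mp hpol
              · rw [if_neg h2] at hfc; norm_num at hfc
            · rw [if_neg hmem] at hfc; norm_num at hfc
          intro c c' hcc' h1 h2
          exact Rdbl c c' hcc' q' hq'0 hq'5 (hx c h1) (hx c' h2)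
      · -- a singleton value: every degree is `0`
        have hzero : ∀ c : Fin C, (if w ∈ V.filter (fun w => (∃ p q : Fin 6, δ0 p + δ0 q = w ∧ polar (W c p) (W c q) ≠ 0))
            then (if δ0 0 + δ0 0 = w ∧ polar (W c 5) (W c 5) ≠ 0 then 2 else if (∃ q : Fin 6, q ≠ 5 ∧ δ0 5 + δ0 q = w ∧ polar (W c 5) (W c q) ≠ 0) then 1 else 0) else 0) = 0 := by
          intro c
          have h1 : ¬ (δ0 0 + δ0 0 = w ∧ polar (W c 5) (W c 5) ≠ 0) := fun h => hA h.1.symm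
          have h2 : ¬ (∃ q : Fin 6, q ≠ 5 ∧ δ0 5 + δ0 q = w ∧ polar (W c 5) (W c q) ≠ 0) := by
            rintro ⟨q, hq5, hq, -⟩
            by_cases hq0 : q = 0
            · subst hq0; exact hA (by rw [← hq, h05])
            · exact hB ⟨q, hq0, hq5, by rw [← hq, h05]⟩
          rw [if_neg h1, if_neg h2, ite_self]
        rw [Finset.sum_eq_zero (fun c _ => hzero c)]
        exact Nat.zero_le _

  -- the ceiling: `20 = Σ m_c ≤ 6 + (|V| − 1) ≤ 19`
  have hcc := chain_ceiling V (fun w => (if w = δ0 0 + δ0 0 then 3 else if (∃ q : Fin 6, q ≠ 0 ∧ q ≠ 5 ∧ w = δ0 0 + δ0 q) then 2 else 1))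
    (fun c => V.filter (fun w => (∃ p q : Fin 6, δ0 p + δ0 q = w ∧ polar (W c p) (W c q) ≠ 0)))
    (fun c w => (if δ0 0 + δ0 0 = w ∧ polar (W c 5) (W c 5) ≠ 0 then 2 else if (∃ q : Fin 6, q ≠ 5 ∧ δ0 5 + δ0 q = w ∧ polar (W c 5) (W c q) ≠ 0) then 1 else 0)) m
    hne' (fun c => Finset.filter_subset _ _) hmono' hsplit hcount
  beta_reduce at hcc
  omega

/-- **NO TWENTIES ACCUMULATE AT A ONE-PAIR POINT ON THE WALL (a) `δ₁ + δ₂ = δ₃ + δ₄` — UNCONDITIONALLY, NO DOOR, NO WINDOW.**  `hgen` = the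
stratum: the only additive relations among the five (distinct) values are the trivial ones and the wall relation. [this work; non-degeneracy W1 #35] -/
theorem onePairWallA_noTwenties (δs : ℕ → Fin 6 → ℝ) (δ0 : Fin 6 → ℝ)
    (hδ : ∀ l, Tendsto (fun ν => δs ν l) atTop (𝓝 (δ0 l))) (h05 : δ0 5 = δ0 0)
    (hrel : δ0 1 + δ0 2 = δ0 3 + δ0 4)
    (hgen : ∀ a b c e : Fin 5, δ0 a.castSucc + δ0 b.castSucc = δ0 c.castSucc + δ0 e.castSucc →
      (a = c ∧ b = e) ∨ (a = e ∧ b = c) ∨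
        (((a = 1 ∧ b = 2) ∨ (a = 2 ∧ b = 1)) ∧ ((c = 3 ∧ e = 4) ∨ (c = 4 ∧ e = 3))) ∨
        (((a = 3 ∧ b = 4) ∨ (a = 4 ∧ b = 3)) ∧ ((c = 1 ∧ e = 2) ∨ (c = 2 ∧ e = 1))))
    (U : ℕ → Fin 6 → Matrix (Fin 2) (Fin 2) ℝ) (hU : ∀ ν l, (U ν l).IsSymm)
    (hne : ∀ ν, ∃ t, (∑ l, Real.exp (δs ν l * t) • U ν l).det ≠ 0)
    (z : ℕ → Fin 20 → ℝ) (hz : ∀ ν, StrictMono (z ν)) (hroot : ∀ ν i, (∑ l, Real.exp (δs ν l * z ν i) • U ν l).det = 0) :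
    False := by
  have hinj : ∀ a b : Fin 5, δ0 a.castSucc = δ0 b.castSucc → a = b := by
    intro a b h
    rcases hgen a a b a (by rw [h]) with ⟨hab, -⟩ | ⟨-, hab⟩ | ⟨h1 | h1, -⟩ | ⟨h1 | h1, -⟩
    · exact hab
    · exact hab
    all_goals (obtain ⟨h1, h2⟩ := h1; rw [h1] at h2; exact absurd h2 (by decide))
  exact onePairWall_noTwenties_of_nondeg δs δ0 hδ h05 hinj ⟨1, 2, 3, 4, by decide, by decide, by decide, hrel⟩
    (fun W hWs hWne => confluentDet_ne_zero_of_polar_ne_zero_wallA δ0 h05 hrel hgen W hWs hWne) U hU hne z hz hroot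

/-- **NO TWENTIES ACCUMULATE AT A ONE-PAIR POINT ON THE WALL (b) `δ₀ + δ₁ = δ₂ + δ₃` — UNCONDITIONALLY, NO DOOR, NO WINDOW.** [this work;
non-degeneracy W1 #35] -/
theorem onePairWallB_noTwenties (δs : ℕ → Fin 6 → ℝ) (δ0 : Fin 6 → ℝ)
    (hδ : ∀ l, Tendsto (fun ν => δs ν l) atTop (𝓝 (δ0 l))) (h05 : δ0 5 = δ0 0)
    (hrel : δ0 0 + δ0 1 = δ0 2 + δ0 3)
    (hgen : ∀ a b c e : Fin 5, δ0 a.castSucc + δ0 b.castSucc = δ0 c.castSucc + δ0 e.castSucc →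
      (a = c ∧ b = e) ∨ (a = e ∧ b = c) ∨
        (((a = 0 ∧ b = 1) ∨ (a = 1 ∧ b = 0)) ∧ ((c = 2 ∧ e = 3) ∨ (c = 3 ∧ e = 2))) ∨
        (((a = 2 ∧ b = 3) ∨ (a = 3 ∧ b = 2)) ∧ ((c = 0 ∧ e = 1) ∨ (c = 1 ∧ e = 0))))
    (U : ℕ → Fin 6 → Matrix (Fin 2) (Fin 2) ℝ) (hU : ∀ ν l, (U ν l).IsSymm)
    (hne : ∀ ν, ∃ t, (∑ l, Real.exp (δs ν l * t) • U ν l).det ≠ 0)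
    (z : ℕ → Fin 20 → ℝ) (hz : ∀ ν, StrictMono (z ν)) (hroot : ∀ ν i, (∑ l, Real.exp (δs ν l * z ν i) • U ν l).det = 0) :
    False := by
  have hinj : ∀ a b : Fin 5, δ0 a.castSucc = δ0 b.castSucc → a = b := by
    intro a b h
    rcases hgen a a b a (by rw [h]) with ⟨hab, -⟩ | ⟨-, hab⟩ | ⟨h1 | h1, -⟩ | ⟨h1 | h1, -⟩
    · exact hab
    · exact hab
    all_goals (obtain ⟨h1, h2⟩ := h1; rw [h1] at h2; exact absurd h2 (by decide))
  exact onePairWall_noTwenties_of_nondeg δs δ0 hδ h05 hinj ⟨0, 1, 2, 3, by decide, by decide, by decide, hrel⟩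
    (fun W hWs hWne => confluentDet_ne_zero_of_polar_ne_zero_wallB δ0 h05 hrel hgen W hWs hWne) U hU hne z hz hroot

end Summit.ValiantsHypothesis.ValiantsHypothesis.Theorems.LacunarySymmetroidMatrixDescartes.WallBubbling
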